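import Mathlib

/-!
# Slaving above the resonance — stub `stub_slavingODE` (M2)

Crux `Summit.AtomisticToContinuum.HydrodynamicLimit.Theses.ImplosionDichotomy.DenseExcursion`
(stmt-AtomisticToContinuum-12586), line `r2-one-mode-two-conditions` (skeleton v8d), registered stub
`stub_slavingODE : SlavingODE` (definition verbatim from the skeleton, §0e).

**Statement.** A scalar unstable coordinate `a′ = Λ a + f` on `[0, τ₁]`, forced by `|f τ| ≤ C ε₀³ e^{3μτ}` with
`3μ > Λ` (`μ > 0`, `C, ε₀ ≥ 0`), obeys `|a τ| ≤ e^{Λτ} |a 0| + C ε₀³ e^{3μτ} / (3μ − Λ)` on `[0, τ₁]`.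

**Proof.** Variation of constants WITHOUT integrals (the forcing `f` is not assumed measurable, let alone
continuous): the conjugated unknown `g τ := e^{−Λτ} a τ` has derivative `g′ τ = e^{−Λτ} f τ` (product rule, the
`Λ`-terms cancel), `|g′ τ| ≤ C ε₀³ e^{(3μ−Λ)τ}`, and the fencing theorem
`image_norm_le_of_norm_deriv_right_le_deriv_boundary` (Mathlib, `Analysis/Calculus/MeanValue`) with the barrier
`B τ := |a 0| + C ε₀³ (e^{(3μ−Λ)τ} − 1) / (3μ − Λ)`, `B′ τ = C ε₀³ e^{(3μ−Λ)τ} ≥ |g′ τ|`, gives `|g τ| ≤ B τ` on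
`[0, τ₁]`; multiplying by `e^{Λτ}` and dropping the `−1` yields the claim. Folklore one-variable calculus; Mathlib
only, no cited facts.
-/

noncomputable section

open Set Filter Topology
open scoped ContDiff

namespace Summit.AtomisticToContinuum.HydrodynamicLimit.Theorems.R2OneModeTwoConditions

/-! ## The statement (verbatim: skeleton §0e) -/

/-- SLAVING ABOVE THE RESONANCE (blueprint §1): a scalar unstable coordinate `a′ = Λ a + f` forced by `|f| ≤ C ε₀³ e^{3μτ}` with
`3μ > Λ` stays `≤ e^{Λτ}|a(0)| + C ε₀³ e^{3μτ}/(3μ − Λ)`: the Duhamel integral converges at its upper end, so an `O(ε₀³)` seed is never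
amplified beyond `O(ε(τ)³) + O(ε₀^{3 − Λ/μ}) ε^{Λ/μ}`. Elementary (variation of constants). -/
def SlavingODE : Prop :=
  ∀ (Λ μ C ε₀ τ₁ : ℝ) (a f : ℝ → ℝ), 0 < μ → Λ < 3 * μ → 0 ≤ C → 0 ≤ ε₀ →
    (∀ τ ∈ Set.Icc 0 τ₁, HasDerivAt a (Λ * a τ + f τ) τ) →
    (∀ τ ∈ Set.Icc 0 τ₁, |f τ| ≤ C * ε₀ ^ 3 * Real.exp (3 * μ * τ)) →
    ∀ τ ∈ Set.Icc 0 τ₁, |a τ| ≤ Real.exp (Λ * τ) * |a 0| + C * ε₀ ^ 3 / (3 * μ - Λ) * Real.exp (3 * μ * τ)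

/-! ## Conjugation by the linear flow and the exponential fence -/

/-- Conjugation by the linear flow `e^{Λτ}`: if `a′(τ) = Λ a(τ) + f(τ)`, then `g := e^{−Λ·} a` has
`g′(τ) = e^{−Λτ} f(τ)` (product rule; the `Λ`-terms cancel). -/
theorem hasDerivAt_expConj {Λ : ℝ} {a f : ℝ → ℝ} {τ : ℝ} (ha : HasDerivAt a (Λ * a τ + f τ) τ) :
    HasDerivAt (fun s => Real.exp (-(Λ * s)) * a s) (Real.exp (-(Λ * τ)) * f τ) τ := by
  have h1 : HasDerivAt (fun s => -(Λ * s)) (-Λ) τ :=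
    ((hasDerivAt_id' τ).const_mul Λ).fun_neg.congr_deriv (by ring)
  exact (h1.exp.fun_mul ha).congr_deriv (by ring)

/-- EXPONENTIAL FENCE (variation of constants without integrals): if `a′ = Λ a + f` on `[0, τ₁]` and
`|f τ| ≤ K e^{(Λ + κ)τ}` there, with `κ > 0`, then the conjugated unknown is fenced by the barrier
`e^{−Λτ} |a τ| ≤ |a 0| + (K/κ)(e^{κτ} − 1)` on `[0, τ₁]`
(`image_norm_le_of_norm_deriv_right_le_deriv_boundary` applied to `g = e^{−Λ·} a`, whose derivative
`e^{−Λτ} f τ` is bounded by the derivative `K e^{κτ}` of the barrier). -/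
theorem expConj_abs_le_barrier {Λ κ K τ₁ : ℝ} {a f : ℝ → ℝ} (hκ : 0 < κ)
    (ha : ∀ τ ∈ Icc 0 τ₁, HasDerivAt a (Λ * a τ + f τ) τ)
    (hf : ∀ τ ∈ Icc 0 τ₁, |f τ| ≤ K * Real.exp ((Λ + κ) * τ)) :
    ∀ τ ∈ Icc 0 τ₁, Real.exp (-(Λ * τ)) * |a τ| ≤ |a 0| + K / κ * (Real.exp (κ * τ) - 1) := by
  intro τ hτ
  -- the conjugated unknown `g = e^{−Λ·} a` and its derivative
  have hgd : ∀ s ∈ Icc 0 τ₁,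
      HasDerivAt (fun s => Real.exp (-(Λ * s)) * a s) (Real.exp (-(Λ * s)) * f s) s :=
    fun s hs => hasDerivAt_expConj (ha s hs)
  -- the barrier and its derivative
  have hBd : ∀ s, HasDerivAt (fun s => |a 0| + K / κ * (Real.exp (κ * s) - 1)) (K * Real.exp (κ * s)) s := by
    intro s
    have h1 : HasDerivAt (fun x => κ * x) κ s := ((hasDerivAt_id' s).const_mul κ).congr_deriv (mul_one κ)
    refine (((h1.exp.sub_const 1).const_mul (K / κ)).const_add |a 0|).congr_deriv ?_
    rw [mul_comm (Real.exp _) κ, ← mul_assoc, div_mul_cancel₀ K hκ.ne']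
  -- initial comparison `‖g 0‖ ≤ B 0`
  have h0 : ‖Real.exp (-(Λ * 0)) * a 0‖ ≤ |a 0| + K / κ * (Real.exp (κ * 0) - 1) := by
    simp
  -- derivative comparison `‖g′ s‖ ≤ B′ s`
  have hbound : ∀ s ∈ Ico 0 τ₁, ‖Real.exp (-(Λ * s)) * f s‖ ≤ K * Real.exp (κ * s) := by
    intro s hs
    rw [Real.norm_eq_abs, abs_mul, Real.abs_exp]
    calc Real.exp (-(Λ * s)) * |f s|
        ≤ Real.exp (-(Λ * s)) * (K * Real.exp ((Λ + κ) * s)) :=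
          mul_le_mul_of_nonneg_left (hf s (Ico_subset_Icc_self hs)) (Real.exp_pos _).le
      _ = K * (Real.exp (-(Λ * s)) * Real.exp (Λ * s)) * Real.exp (κ * s) := by
          rw [show (Λ + κ) * s = Λ * s + κ * s by ring, Real.exp_add]
          ring
      _ = K * Real.exp (κ * s) := by
          rw [← Real.exp_add, neg_add_cancel, Real.exp_zero, mul_one]
  -- the fencing theorem
  have key := image_norm_le_of_norm_deriv_right_le_deriv_boundary
    (f := fun s => Real.exp (-(Λ * s)) * a s) (B := fun s => |a 0| + K / κ * (Real.exp (κ * s) - 1))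
    (fun s hs => (hgd s hs).continuousAt.continuousWithinAt)
    (fun s hs => (hgd s (Ico_subset_Icc_self hs)).hasDerivWithinAt) h0 hBd hbound hτ
  simpa [Real.norm_eq_abs, abs_mul, Real.abs_exp] using key

/-! ## The slaving lemma (M2) -/

/-- **SLAVING ABOVE THE RESONANCE** (stub M2): for `a′ = Λ a + f` on `[0, τ₁]` with `|f τ| ≤ C ε₀³ e^{3μτ}`,
`3μ > Λ`, `μ > 0`, `C, ε₀ ≥ 0`: `|a τ| ≤ e^{Λτ} |a 0| + C ε₀³ e^{3μτ} / (3μ − Λ)` on `[0, τ₁]`. The exponential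
fence `expConj_abs_le_barrier` with `K = C ε₀³`, `κ = 3μ − Λ > 0`, multiplied back by `e^{Λτ}`, the `−1` of the
barrier dropped (`C ε₀³ e^{Λτ} / (3μ − Λ) ≥ 0`). [folklore] -/
theorem stub_slavingODE : SlavingODE := by
  intro Λ μ C ε₀ τ₁ a f _hμ hΛ hC hε ha hf τ hτ
  have hκ : 0 < 3 * μ - Λ := sub_pos.mpr hΛ
  have hf' : ∀ s ∈ Icc 0 τ₁, |f s| ≤ C * ε₀ ^ 3 * Real.exp ((Λ + (3 * μ - Λ)) * s) := by
    intro s hs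
    rw [add_sub_cancel]
    exact hf s hs
  -- the fence for `e^{−Λτ} |a τ|`, multiplied by `e^{Λτ} > 0`
  have hmul := mul_le_mul_of_nonneg_left (expConj_abs_le_barrier hκ ha hf' τ hτ) (Real.exp_pos (Λ * τ)).le
  have hexp : Real.exp (Λ * τ) * Real.exp (-(Λ * τ)) = 1 := by
    rw [← Real.exp_add, add_neg_cancel, Real.exp_zero]
  have h3 : Real.exp (Λ * τ) * Real.exp ((3 * μ - Λ) * τ) = Real.exp (3 * μ * τ) := by
    rw [← Real.exp_add]
    congr 1
    ring
  rw [← mul_assoc, hexp, one_mul] at hmul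
  -- drop the `−1` of the barrier
  have hdrop : 0 ≤ C * ε₀ ^ 3 / (3 * μ - Λ) * Real.exp (Λ * τ) := by positivity
  calc |a τ| ≤ Real.exp (Λ * τ) * (|a 0| + C * ε₀ ^ 3 / (3 * μ - Λ) * (Real.exp ((3 * μ - Λ) * τ) - 1)) := hmul
    _ = Real.exp (Λ * τ) * |a 0| + C * ε₀ ^ 3 / (3 * μ - Λ) * Real.exp (3 * μ * τ)
          - C * ε₀ ^ 3 / (3 * μ - Λ) * Real.exp (Λ * τ) := by
        rw [← h3]
        ring
    _ ≤ Real.exp (Λ * τ) * |a 0| + C * ε₀ ^ 3 / (3 * μ - Λ) * Real.exp (3 * μ * τ) := by linarith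

end Summit.AtomisticToContinuum.HydrodynamicLimit.Theorems.R2OneModeTwoConditions

end
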